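import Summits.QuantumFields.BalabanUV.Beta.D1BFx.KCombineCovCombLeg
import Summits.QuantumFields.BalabanUV.Beta.D1BFx.TorusJetArrays

/-!
# `BalabanUV.Beta.D1BFx.CombFPWordArrays` — road «BF-x» for binder row D1, slot (K), (K) CLOSURE PLAN (R1-L) v0.2 §7 row **(A2-τ) «COMB-FP WORD ARRAYS»**:
# the site words of the comb-FP slot of `KCombineCov.identity_array_currency_cov_What0` (p251661) at THE CONVENTION's gauge jets `Wₛ = Ê_b·N̂`
# (`KGramCovJets`, p254145; owner d1-p2-g9 l.28646) ARE PERIODISED ARRAYS OF ONE FIXED `ℤ⁴` FAMILY: **`N̂F·Ê_{(σu,κ)} = (arr s (nFcol κ u))^`** with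
# `nFcol κ u (x, y) := λ_{(κ,u)}(x)·[y = u + e_κ]` (the block-mean-free comb gauge function of the fine bond `(u, κ)` placed at the column `u + e_κ`), bi-localised
# at `(u, u + e_κ)` for EVERY rate with an `n`-dependent, `p`-free constant — so the comb-FP functional `heτ` of §3′ (`KCombineCovCombLeg.hessT_combFP_What0_eq_idK1`,
# p253347) is LITERALLY in the currency of the socket `tendsto_hessT_Gtau` (this lineage's follow-up to l.28692 (α))

HONEST FRAMING (cell contract, verbatim): «discharging `BetaPertH` makes Bałaban's UV stability UNCONDITIONAL — a real constructive-QFT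
result; it is NOT the continuum limit and NOT the Clay problem.»  HONEST DEPENDENCY (verbatim): «continuum YM on T⁴ ⇐ BetaPertH ∧ nine
spine estimates (0/9 proved); BetaPertH ⇐ (D1) ∧ (D4) ∧ CAP+tail; G-an2-4 gates asym, D1 and NE2/3/4.»  THIS MODULE DISCHARGES NOTHING of
D1 ∕ BetaPertH: ONE [our object] data definition (`nFcol`, asserting nothing) and [folklore] lattice bookkeeping BY NAME over this lineage's
`TorusGaugeBasisMatrix` (`bmF`, `NhatF`, `isPeriodic₂_bmF`, `rowBound_bmF`, `abs_bmF_le`, `bmGaugeAt_shift`, `shift_delta1`), an1's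
`BorderedHessian.bmGaugeAt_delta1_eq_zero` (block support), an4's `periodise₂_eq_tsum_of_rep`, TA2 `PeriodicArrays` (`arr`, `periodise₂_arr`), this lineage's
`TorusJetArrays` (`tsum_ind`, `tip_siteOf`), `TorusCoframeJets.Djet`, `KGhostTerm.submatrix_mul_submatrix_equiv` and `KCombineCovCombLeg` (p253347).  No `def … : Prop`,
nothing cited, 0 sorry.  DISPLAYED: the gauge-jet letters `hW•` (THE CONVENTION).  NOT summit progress; NOT BetaPertH, NOT continuum, NOT Clay.

ABSOLUTE RULE (cell, verbatim): «No internally-minted statement may enter as a cited fact. Every hypothesis is either kernel-proved in this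
package or a verbatim quotation of a PUBLISHED theorem with page reference. The manuscript(s) under audit are NOT citable for their own
disputed steps — they are the thing under adjudication; programme-internal (2001/route/tribunal) claims are never citable.»

CONTENT (root `r ∈ box 4 n`, block side `n`, fine torus `Site 4 (n·p)`; all [folklore] unless marked).
* §1 [our object] `nFcol`; `nFcol_apply`, `nFcol_eq_zero_of_far` (block support), `l1_le_of_abs_lt`, **`biLoc_nFcol`** (`BiLoc (nFcol κ u) u (u + e_κ) (8n·e^{4nδ}) δ`, every `δ ≥ 0`).
* §2 `tsum_bmF_imageShift` (the image sum of `λ_{(κ,u)}` over the SITE equals the image sum over the BOND = `N̂F x̄ (σu, κ)`: coarse-translation covariance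
  `bmGaugeAt_shift` + `t ↦ −t`), **`NhatF_mul_Djet_eq_arr`** (`(N̂F·Ê_{(σu,κ)})ᶠ = (arr s (nFcol κ u))^`).
* §3 **`hessT_combFP_What0_eq_arr`** — the §3′ comb-FP functional at THE CONVENTION's gauge jets (letters `hW•`, mixed jet `[b = b′]•Wₛ`) EQUALS
  `hessT ((idK1)^; (arr s (nFcol μ u))^, (arr s (nFcol ν u′))^, (arr s ([b = b′]•nFcol μ u))^)`, `b = (σu, μ)`, `b′ = (σu′, ν)` — the `hGtau`-socket currency of
  `KCombineCov` §4 (for `s > |u − u′|₁` the torus coincidence `b = b′` is the `ℤ⁴` one, `TorusGhostPairStencils.eq_of_siteOf_eq`; not restated here).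
Unit `b2b-balaban-beta-d1-formalise-leaf-03` (gen 11); road owner `b2b-balaban-beta-d1-p2`.
-/

noncomputable section

namespace Summit.QuantumFields.BalabanUV.Beta.D1BFx.CombFPWordArrays

open Matrix
open scoped BigOperators
open Literature.MathematicalPhysics.QuantumFieldTheory.Balaban1983to89
open Literature.MathematicalPhysics.QuantumFieldTheory.Balaban1983to89.Beta
open B12Sec2to5 (l1 l1_nonneg)
open ExpKernelCalculus (MKer BiLoc)
open AffineAveraging (box toSite unitVec)
open AveragingContours (shift)
open KKTFluctuationKernel (delta1 delta1_apply)
open Summit.QuantumFields.BalabanUV.Beta.AxialProjectorBlockMean (bmGaugeAt)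
open Summit.QuantumFields.BalabanUV.Beta.BorderedHessian (bmGaugeAt_delta1_eq_zero)
open Summit.QuantumFields.BalabanUV.Beta.D1BFx.FibredPeriodisation (Kfib Kfib_apply periodiseF periodiseF_apply)
open Summit.QuantumFields.BalabanUV.Beta.D1BFx.PeriodicArrays (arr arr_apply toF toF_apply Kfib_toF periodise₂_arr)
open Summit.QuantumFields.BalabanUV.Beta.D1BFx.SortedReblocking (imageShift_mul_eq_add)
open Summit.QuantumFields.BalabanUV.Beta.D1BFx.SortedEmbedding (e₁)
open Summit.QuantumFields.BalabanUV.Beta.D1BFx.MixedVarPackedHess (hessT)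
open Summit.QuantumFields.BalabanUV.Beta.D1BFx.TorusCombKKT (I J CombRows tauT)
open Summit.QuantumFields.BalabanUV.Beta.D1BFx.TorusGaugeBasisMatrix (bmF NhatF Nhat isPeriodic₂_bmF rowBound_bmF abs_bmF_le bmGaugeAt_shift shift_delta1)
open Summit.QuantumFields.BalabanUV.Beta.D1BFx.TorusCoframeJets (tip Djet Djet_apply)
open Summit.QuantumFields.BalabanUV.Beta.D1BFx.TorusJetArrays (tsum_ind tip_siteOf)
open Summit.QuantumFields.BalabanUV.Beta.D1BFx.GhostStencil (l1_zero)
open Summit.QuantumFields.BalabanUV.Beta.D1BFx.GaugeJetLocal (idK1)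
open Summit.QuantumFields.BalabanUV.Beta.D1BFx.KGhostTerm (submatrix_mul_submatrix_equiv)
open Summit.QuantumFields.BalabanUV.Beta.D1BFx.KCombineCovCombLeg (hessT_combFP_What0_eq_idK1)

variable (r : Fin (3 + 1) → ℕ) (n : ℕ) [NeZero n]

/-! ## §1 The `ℤ⁴` family of the comb-FP words and its localisation -/

/-- [our object] **THE COMB-FP WORD FAMILY** `nFcol κ u (x, y) := λ_{(κ,u)}(x)·[y = u + e_κ]`: the block-mean-free comb gauge function of the fine bond
`(u, κ)` (`TorusGaugeBasisMatrix.bmF`) as a column placed at the bond's far endpoint.  A definition (scalar fibre `Unit`); asserts nothing. -/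
def nFcol (κ : Fin 4) (u : Fin 4 → ℤ) : MKer 4 Unit :=
  fun x y _ _ => bmF r n (x, ()) (u, κ) * (if y = u + unitVec κ then 1 else 0)

variable (κ : Fin 4) (u : Fin 4 → ℤ)

omit [NeZero n] in
/-- [our object] Unfolding `nFcol`. -/
theorem nFcol_apply (x y : Fin 4 → ℤ) (a b : Unit) :
    nFcol r n κ u x y a b = bmGaugeAt (toSite r) (delta1 κ u) n x * (if y = u + unitVec κ then 1 else 0) := rfl

variable {r n}

/-- [folklore] **BLOCK SUPPORT**: `nFcol κ u (x, ·) = 0` as soon as one coordinate of `x` is at distance `≥ n` from `u` (`bmGaugeAt_delta1_eq_zero`). -/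
theorem nFcol_eq_zero_of_far (hr : r ∈ box (3 + 1) n) {x : Fin 4 → ℤ} {j : Fin 4} (hj : (n : ℤ) ≤ |x j - u j|) (y : Fin 4 → ℤ) (a b : Unit) :
    nFcol r n κ u x y a b = 0 := by
  rw [nFcol_apply, bmGaugeAt_delta1_eq_zero (NeZero.one_le (n := n)) hr hj, zero_mul]

omit [NeZero n] in
/-- [folklore] If every coordinate of `x − u` is `< n` in absolute value then `|x − u|₁ ≤ 4n`. -/
theorem l1_le_of_abs_lt {x u : Fin 4 → ℤ} (h : ∀ j, |x j - u j| < (n : ℤ)) : l1 (x - u) ≤ 4 * (n : ℝ) := by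
  unfold B12Sec2to5.l1
  calc ∑ μ, |(((x - u) μ : ℤ) : ℝ)| ≤ ∑ _μ : Fin 4, (n : ℝ) := Finset.sum_le_sum fun μ _ => by
          rw [Pi.sub_apply, ← Int.cast_abs]
          exact_mod_cast (h μ).le
    _ = 4 * (n : ℝ) := by rw [Finset.sum_const, Finset.card_univ, Fintype.card_fin, nsmul_eq_mul, Nat.cast_ofNat]

/-- [folklore] **LOCALISATION OF THE COMB-FP WORDS**: `BiLoc (nFcol κ u) u (u + e_κ) (8n·e^{4nδ}) δ` for every `δ ≥ 0` — the constant depends on the block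
side `n` (fixed along the road's tori), not on the period. -/
theorem biLoc_nFcol (hr : r ∈ box (3 + 1) n) {δ : ℝ} (hδ : 0 ≤ δ) :
    BiLoc (nFcol r n κ u) u (u + unitVec κ) (2 * (((3 : ℝ) + 1) * n) * Real.exp (δ * (4 * n))) δ := by
  intro x y a b
  by_cases hy : y = u + unitVec κ
  · by_cases hx : ∀ j, |x j - u j| < (n : ℤ)
    · have hl := l1_le_of_abs_lt (n := n) hx
      rw [nFcol_apply, if_pos hy, mul_one, hy, sub_self, l1_zero, add_zero]
      calc |bmGaugeAt (toSite r) (delta1 κ u) n x| ≤ 2 * (((3 : ℝ) + 1) * n) := abs_bmF_le r n hr x u κ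
        _ = 2 * (((3 : ℝ) + 1) * n) * (Real.exp (δ * (4 * n)) * Real.exp (-(δ * (4 * n)))) := by
            rw [← Real.exp_add, add_neg_cancel, Real.exp_zero, mul_one]
        _ ≤ 2 * (((3 : ℝ) + 1) * n) * (Real.exp (δ * (4 * n)) * Real.exp (-δ * l1 (x - u))) := by
            refine mul_le_mul_of_nonneg_left (mul_le_mul_of_nonneg_left (Real.exp_le_exp.mpr ?_) (Real.exp_pos _).le) (by positivity)
            nlinarith
        _ = 2 * (((3 : ℝ) + 1) * n) * Real.exp (δ * (4 * n)) * Real.exp (-δ * l1 (x - u)) := by ring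
    · obtain ⟨j, hj⟩ := not_forall.mp hx
      rw [nFcol_eq_zero_of_far κ u hr (not_lt.mp hj) y a b, abs_zero]
      positivity
  · rw [nFcol_apply, if_neg hy, mul_zero, abs_zero]
    positivity

/-! ## §2 The torus letter: `N̂F·Ê_{(σu,κ)}` is the periodised array of `nFcol κ u` -/

section Torus

variable (r n) (p : ℕ) [NeZero p]

omit [NeZero p] in
/-- [folklore] **SITE IMAGES = BOND IMAGES**: `Σ'_t λ_{(κ,u)}(x + (np)·t) = Σ'_t λ_{(κ, u + (np)·t)}(x)` (coarse-translation covariance `bmGaugeAt_shift`,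
`shift_delta1`, and the reflection `t ↦ −t` of the image lattice). -/
theorem tsum_bmF_imageShift (x : Fin 4 → ℤ) :
    ∑' t : Fin 4 → ℤ, bmGaugeAt (toSite r) (delta1 κ u) n (imageShift (n * p) x t)
      = ∑' t : Fin 4 → ℤ, bmGaugeAt (toSite r) (delta1 κ (imageShift (n * p) u t)) n x := by
  rw [← (Equiv.neg (Fin 4 → ℤ)).tsum_eq]
  refine tsum_congr fun t => ?_
  rw [Equiv.neg_apply, imageShift_mul_eq_add, imageShift_mul_eq_add, bmGaugeAt_shift _ (NeZero.one_le (n := n))]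
  congr 1
  rw [show delta1 κ u = delta1 κ ((u + (n : ℤ) • ((p : ℤ) • t)) + (n : ℤ) • ((p : ℤ) • -t)) by
    rw [smul_neg, smul_neg, add_neg_cancel_right], shift_delta1]

/-- [folklore] **THE TORUS LETTER OF THE COMB-FP WORDS**: on the fine torus `Site 4 (n·p)`, for the torus image `(σu, κ)` of the `ℤ⁴` bond `(u, κ)`,
`(N̂F · Ê_{(σu,κ)})ᶠ = (arr (n·p) (nFcol κ u))^` — the periodised comb gauge functions times the single-entry jet `Ê` form the fibrewise periodisation of TA2's
array of ONE fixed `ℤ⁴` kernel. -/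
theorem NhatF_mul_Djet_eq_arr (hr : r ∈ box (3 + 1) n) :
    (NhatF r n (n * p) * Djet (n * p) (siteOf 4 (n * p) u, κ)).submatrix Prod.fst Prod.fst
      = Matrix.of (periodiseF (n * p) (toF (arr (n * p) (nFcol r n κ u)))) := by
  ext ⟨x, a⟩ ⟨z, b⟩
  rw [Matrix.submatrix_apply, Matrix.of_apply, Matrix.mul_apply, Finset.sum_eq_single (siteOf 4 (n * p) u, κ)]
  · -- the left entry: `N̂F x̄ (σu,κ) · [z̄ = σ(u + e_κ)]`
    rw [Djet_apply, tip_siteOf]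
    have hN : NhatF r n (n * p) x (siteOf 4 (n * p) u, κ)
        = ∑' t : Fin 4 → ℤ, bmGaugeAt (toSite r) (delta1 κ (imageShift (n * p) u t)) n (windowMap 4 (n * p) x) := by
      have hper : IsPeriodic₂ (n * p) (Kfib (bmF r n) () κ) := isPeriodic₂_bmF r n p () κ
      have hrow : ∀ w, Summable (Kfib (bmF r n) () κ w) := fun w => (rowBound_bmF r n hr () κ w).1.of_abs
      exact periodise₂_eq_tsum_of_rep hper hrow (siteOf_windowMap 4 (n * p) x) rfl
    -- the right entry
    rw [periodiseF_apply, periodise₂_arr (biLoc_nFcol κ u hr zero_le_one) one_pos]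
    simp only [nFcol_apply]
    have hin : ∀ t : Fin 4 → ℤ, ∑' m : Fin 4 → ℤ, bmGaugeAt (toSite r) (delta1 κ u) n (imageShift (n * p) (windowMap 4 (n * p) x) t)
          * (if imageShift (n * p) (windowMap 4 (n * p) z) m = u + unitVec κ then (1 : ℝ) else 0)
        = bmGaugeAt (toSite r) (delta1 κ u) n (imageShift (n * p) (windowMap 4 (n * p) x) t)
          * (if z = siteOf 4 (n * p) (u + unitVec κ) then (1 : ℝ) else 0) := by
      intro t; rw [tsum_mul_left, tsum_ind]
    rw [tsum_congr hin, tsum_mul_right, tsum_bmF_imageShift r n κ u p, ← hN]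
    simp only [true_and]
  · intro j _ hj
    rw [Djet_apply, if_neg (fun h => hj h.1), mul_zero]
  · intro h; exact absurd (Finset.mem_univ _) h

/-- [folklore] The same letter in SORTED currency: `(N̂F.submatrix id e₁)·(Ê.submatrix e₁ id) = N̂F·Ê` (`KGhostTerm.submatrix_mul_submatrix_equiv`). -/
theorem NhatF_sub_mul_Djet_sub_eq_arr (hr : r ∈ box (3 + 1) n) :
    ((NhatF r n (n * p)).submatrix id (e₁ n p) * (Djet (n * p) (siteOf 4 (n * p) u, κ)).submatrix (e₁ n p) id).submatrix Prod.fst Prod.fst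
      = Matrix.of (periodiseF (n * p) (toF (arr (n * p) (nFcol r n κ u)))) := by
  rw [submatrix_mul_submatrix_equiv, NhatF_mul_Djet_eq_arr r n κ u p hr]

/-- [folklore] The zero family periodises to the zero matrix. -/
theorem periodiseF_toF_arr_zero (s : ℕ) [NeZero s] :
    Matrix.of (periodiseF s (toF (arr s (0 : MKer 4 Unit)))) = 0 := by
  ext ⟨x, a⟩ ⟨z, b⟩
  rw [Matrix.of_apply, periodiseF_apply, Matrix.zero_apply]
  have h0 : Kfib (toF (arr s (0 : MKer 4 Unit))) a b = fun _ _ => (0 : ℝ) := by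
    funext w w'
    rw [Kfib_toF]
    show arr s 0 w w' a b = 0
    rw [arr_apply]
    exact tsum_zero
  rw [h0]
  exact FibredPeriodisation.periodise₂_zero x z

end Torus

/-! ## §3 The comb-FP functional of `KCombineCov` §3′ in the `hGtau`-socket currency -/

section Road

variable (m : ℕ) (p : ℕ) [NeZero p] {r : Fin 4 → ℕ}

/-- [folklore] **(A2-τ): THE COMB-FP FUNCTIONAL `heτ` AT THE CONVENTION's GAUGE JETS IS A ONE-LOOP FUNCTIONAL OF THE IDENTITY LEG AGAINST PERIODISED
ARRAYS.**  For `ℤ⁴` bonds `(u, μ)`, `(u′, ν)` with torus images `b = (σu, μ)`, `b′ = (σu′, ν)` and the gauge jets `Wₛ = Ê_b·N̂`, `Wₜ = Ê_{b′}·N̂`,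
`Wₛₜ = [b = b′]•Ê_b·N̂` (letters, in sorted currency):
`hessT (1; τ_T·Wₛ, τ_T·Wₜ, τ_T·Wₛₜ) = hessT ((idK1)^; (arr s (nFcol μ u))^, (arr s (nFcol ν u′))^, (arr s (if b = b′ then nFcol μ u else 0))^)`, `s = (m+1)·p`
(`KCombineCovCombLeg.hessT_combFP_What0_eq_idK1` ∘ §2). -/
theorem hessT_combFP_What0_eq_arr (hr : r ∈ box (3 + 1) (m + 1)) (μ ν : Fin 4) (u u' : Fin 4 → ℤ)
    {Wₛ Wₜ Wₛₜ : Matrix (I 3 (m + 1) p) (CombRows (toSite r) (m + 1) p) ℝ}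
    (hWₛ : Wₛ = (Djet ((m + 1) * p) (siteOf 4 ((m + 1) * p) u, μ)).submatrix (e₁ (m + 1) p) id * Nhat r (m + 1) p)
    (hWₜ : Wₜ = (Djet ((m + 1) * p) (siteOf 4 ((m + 1) * p) u', ν)).submatrix (e₁ (m + 1) p) id * Nhat r (m + 1) p)
    (hWₛₜ : Wₛₜ = if (siteOf 4 ((m + 1) * p) u, μ) = (siteOf 4 ((m + 1) * p) u', ν)
      then (Djet ((m + 1) * p) (siteOf 4 ((m + 1) * p) u, μ)).submatrix (e₁ (m + 1) p) id * Nhat r (m + 1) p else 0) :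
    hessT (1 : Matrix (CombRows (toSite r) (m + 1) p) (CombRows (toSite r) (m + 1) p) ℝ)
        (tauT (toSite r) (m + 1) p * Wₛ) (tauT (toSite r) (m + 1) p * Wₜ) (tauT (toSite r) (m + 1) p * Wₛₜ)
      = hessT (Matrix.of (periodiseF ((m + 1) * p) (toF idK1)))
          (Matrix.of (periodiseF ((m + 1) * p) (toF (arr ((m + 1) * p) (nFcol r (m + 1) μ u)))))
          (Matrix.of (periodiseF ((m + 1) * p) (toF (arr ((m + 1) * p) (nFcol r (m + 1) ν u')))))
          (Matrix.of (periodiseF ((m + 1) * p) (toF (arr ((m + 1) * p)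
            (if (siteOf 4 ((m + 1) * p) u, μ) = (siteOf 4 ((m + 1) * p) u', ν) then nFcol r (m + 1) μ u else 0))))) := by
  have hWₛₜ' : Wₛₜ = (if (siteOf 4 ((m + 1) * p) u, μ) = (siteOf 4 ((m + 1) * p) u', ν)
      then (Djet ((m + 1) * p) (siteOf 4 ((m + 1) * p) u, μ)).submatrix (e₁ (m + 1) p) id else 0) * Nhat r (m + 1) p := by
    rw [hWₛₜ]; split_ifs <;> simp
  rw [hessT_combFP_What0_eq_idK1 m p hr _ _ _ hWₛ hWₜ hWₛₜ', NhatF_sub_mul_Djet_sub_eq_arr r (m + 1) μ u p hr,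
    NhatF_sub_mul_Djet_sub_eq_arr r (m + 1) ν u' p hr]
  by_cases h : (siteOf 4 ((m + 1) * p) u, μ) = (siteOf 4 ((m + 1) * p) u', ν)
  · rw [if_pos h, if_pos h, NhatF_sub_mul_Djet_sub_eq_arr r (m + 1) μ u p hr]
  · rw [if_neg h, if_neg h, Matrix.mul_zero, periodiseF_toF_arr_zero]
    rfl

end Road

end Summit.QuantumFields.BalabanUV.Beta.D1BFx.CombFPWordArrays

end
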